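import Literature.Geometry.Lorentzian.CompleteStationaryVacuumFlat
import Literature.Geometry.Lorentzian.LeviCivitaProofs
import Literature.Geometry.Lorentzian.GeodesicProofs
import HarnessLib

/-!
# Complete stationary vacuum space-times (Anderson 2000): the setting of §0–§1.1, proved

Companion of `Literature.Geometry.Lorentzian.CompleteStationaryVacuumFlat`, which vendors
M. T. Anderson, *On stationary vacuum solutions to the Einstein equations*, Ann. Henri Poincaré 1
(2000) 977–994 (arXiv:gr-qc/0001091), **Theorem 0.1**, as the named fact
`Anderson2000_completeStationaryVacuumFlat`. This file proves, in the vocabulary of the Lorentz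
prelude, the elementary statements of Anderson's §0 and §1.1 that set up the orbit-space picture
of a stationary space-time — the part of the printed argument that is expressible without a
quotient manifold:

* `PseudoRiemannianMetric.IsKillingField.mvfderiv_val_self_apply_self`: for a Killing field `X`,
  `X⟨X, X⟩ = 0` (Killing equation `g(∇_X X, X) + g(X, ∇_X X) = 0` and metric compatibility of the
  Levi-Civita connection, `isLeviCivita_leviCivita_holds`);
* `PseudoRiemannianMetric.IsKillingField.val_self_apply_eq_of_isMIntegralCurve`: hence
  `⟨X, X⟩` is constant along every integral curve of `X` — Anderson's lapse
  `u² = -⟨X, X⟩` ((0.2)) is invariant under the isometry group `G` and "descends to `S`";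
* `LorentzianMetric.IsStationaryKilling.neg_val_self_pos`: `u² = -⟨X, X⟩ > 0` ((0.2));
* `LorentzianMetric.IsStationaryKilling.isFutureTimelikeCurveOn_of_isMIntegralCurve`: the orbits
  of `G` (integral curves of `X`) are future-directed timelike curves ("whose orbits are time-like
  curves in `M`", §0);
* `LorentzianMetric.IsStationaryKilling.injective_of_isChronological`,
  `….not_periodic_of_isChronological`: under the chronology condition every orbit is an injective
  curve, i.e. the isometric `ℝ`-action generated by a complete everywhere-timelike Killing field
  is **free** and `G ≈ ℝ` (not `S¹`) — §0 ("`G ≈ ℝ`", "`M` admits no closed time-like curves")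
  and §1.1 ("if `(M, g)` is not chronological … One may for instance take a `ℤ`-quotient").

All statements are proved for a general time-oriented `C^n` Lorentzian manifold (`n ≥ 1`) and a
stationary Killing field with `M_ext = univ`; they apply verbatim to `𝓢.IsStationaryKilling X univ`
for a bundled `𝓢 : Spacetime 4` (the abbreviation unfolds).

## What is NOT here: the discharge `Anderson2000_completeStationaryVacuumFlat_holds`

Theorem 0.1 itself is not proved in the tree. Its printed proof (Anderson 2000, §1–§2) runs:
(1) the orbit space `S = M/G` is a smooth `3`-manifold, `π : M → S` a principal `ℝ`-bundle,
`g_M = -u²(dt + θ)² + π^* g_S` ((0.1)), and `(M, g_M)` is geodesically complete iff `(S, g_S)` is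
complete (Lemma 1.1); (2) the vacuum equations descend to the system (1.3)–(1.6) for
`(g_S, u, ω)`, `ω` the twist form; (3) Lemmas 1.3–1.5: Cheeger–Gromov convergence and collapse
of `3`-manifolds with bounded Ricci curvature (F-structures, Seifert fibred domains, unwrapping
by covers) with an elliptic-regularity bootstrap (Harnack inequality, `L^p` estimates, harmonic
coordinates), and a point-picking blow-up producing a complete non-flat limit with `|r| ≤ 1`;
(4) §2: in the conformal metric `ḡ = u² g_S` the Ernst map `E = (φ, u²) : (S, ḡ) → H²` is
harmonic with `r̄ = ½ E^*(g₋₁) ≥ 0`, the harmonic-map Bochner formula makes `e(E)` (Step I) and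
`h = u² s̄` (Step II, weighted inequality (2.24)) subsolutions, and a maximum principle at
infinity along a maximising sequence (using (3)) forces `h ≡ 0`, i.e. `u = const`, `ω = 0`,
whence `g_S` and `g_M` are flat. None of the theories in (1)–(4) — quotient manifolds and
Riemannian submersions, Cheeger–Gromov compactness/collapse, elliptic regularity on manifolds,
harmonic maps and their Bochner identity, the Omori–Yau maximum principle — is available in
Mathlib or in `Literature/` at present, and by the fact discipline (D-0026) none of them is
introduced here as an unproved hypothesis.

## References

* M. T. Anderson, *On stationary vacuum solutions to the Einstein equations*, Ann. Henri
  Poincaré 1 (2000) 977–994, §0 ((0.1), (0.2), Thm. 0.1), §1.1 (Lemma 1.1 and the discussion of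
  the chronology condition), §1.3 (Lemmas 1.3–1.5), §2 (proof of Thm. 0.1) (key `Anderson2000`).
* B. O'Neill, *Semi-Riemannian geometry*, Academic Press 1983, Ch. 9, Def. 9.22–Prop. 9.25
  (Killing fields), Ch. 14, p. 407 (chronology condition) (key `ONeill1983`).
-/

noncomputable section

open Bundle Set Manifold TopologicalSpace
open scoped ContDiff Topology Manifold

namespace Literature.Geometry.Lorentzian

variable {E : Type*} [NormedAddCommGroup E] [NormedSpace ℝ E] {H : Type*} [TopologicalSpace H]
  {I : ModelWithCorners ℝ E H} {M : Type*} [TopologicalSpace M] [ChartedSpace H M]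
  [IsManifold I ∞ M] {n : ℕ∞ω}

/-! ### The velocity of an integral curve -/

omit [IsManifold I ∞ M] in
/-- The velocity of an integral curve `γ` of a vector field `X` at the parameter `t` is
`X (γ t)` (Mathlib's `IsMIntegralCurve` records the manifold derivative `1 ↦ X (γ t)`).
O'Neill 1983, Ch. 1, Def. 1.46 (integral curves). [folklore] -/
theorem velocity_eq_of_isMIntegralCurve {X : Π x : M, TangentSpace I x} {γ : ℝ → M}
    (hγ : IsMIntegralCurve γ X) (t : ℝ) : velocity I γ t = X (γ t) := by
  rw [velocity, (hγ t).mfderiv]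
  exact one_smul ℝ _

/-! ### Killing fields: `⟨X, X⟩` is constant along the flow of `X` -/

namespace PseudoRiemannianMetric

variable [FiniteDimensional ℝ E] [CompleteSpace E] [Fact (1 ≤ n)]
  {g : PseudoRiemannianMetric I n E (TangentSpace I : M → Type _)} [g.HasLeviCivita]
  {X : Π x : M, TangentSpace I x}

/-- The regularity exponent of a metric admitting the Levi-Civita API is non-zero (`1 ≤ n`).
[folklore] -/
private lemma n_ne_zero : n ≠ 0 := by
  intro h
  have h1 : (1 : ℕ∞ω) ≤ n := Fact.out
  rw [h] at h1
  exact absurd h1 (by decide)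

omit [FiniteDimensional ℝ E] [CompleteSpace E] in
/-- A Killing field is differentiable at every point (it is `C^n`, `n ≥ 1`). O'Neill 1983, Ch. 9,
Def. 9.22. [cite: ONeill1983, Ch. 9, Def. 9.22] -/
theorem IsKillingField.mdifferentiableAt (hX : g.IsKillingField X) (x : M) : MDiffAt (T% X) x :=
  (hX.contMDiff x).mdifferentiableAt n_ne_zero

/-- **`X⟨X, X⟩ = 0` for a Killing field `X`.** The derivative of the scalar function
`y ↦ g_y(X_y, X_y)` at `x` in the direction `X x` vanishes: by compatibility of the Levi-Civita
connection (`isLeviCivita_leviCivita_holds`) it equals `g(∇_X X, X) + g(X, ∇_X X)`, which is the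
Killing equation `g(∇_Y X, Z) + g(Y, ∇_Z X) = 0` at `Y = Z = X x`. This is the infinitesimal form
of the `G`-invariance of Anderson's lapse `u² = -⟨X, X⟩` (Anderson 2000, §0, (0.2): `u` is a
function on the orbit space `S`); O'Neill 1983, Ch. 9, Prop. 9.25. [cite: Anderson2000, §0, (0.2)] -/
theorem IsKillingField.mvfderiv_val_self_apply_self (hX : g.IsKillingField X) (x : M) :
    mvfderiv I (fun y ↦ g.val y (X y) (X y)) x (X x) = 0 := by
  have hLC : g.IsLeviCivita g.leviCivita := isLeviCivita_leviCivita_holds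
  have hXd : MDiffAt (T% X) x := hX.mdifferentiableAt x
  rw [hLC.2 hXd hXd hXd]
  exact hX.val_leviCivita_add x (X x) (X x)

/-- **`⟨X, X⟩` is constant along the integral curves of a Killing field `X`.** For an integral
curve `γ : ℝ → M` of `X`, `g_{γ s}(X, X) = g_{γ t}(X, X)` for all `s, t`: the real function
`t ↦ g_{γ t}(X_{γ t}, X_{γ t})` has derivative `dg(X,X)_{γ t}(γ' t) = X⟨X, X⟩ (γ t) = 0`
(`mvfderiv_val_self_apply_self`, chain rule `hasDerivAt_comp_curve`), hence is constant
(Mathlib's `is_const_of_deriv_eq_zero`). In Anderson's setting this says that the lapse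
`u² = -⟨X, X⟩ > 0` of a stationary space-time is invariant under the isometry group `G ≈ ℝ`
generated by `X`, i.e. is a function on the orbit space `S` (Anderson 2000, §0, (0.1)–(0.2)).
[cite: Anderson2000, §0, (0.1)–(0.2)] -/
theorem IsKillingField.val_self_apply_eq_of_isMIntegralCurve (hX : g.IsKillingField X)
    {γ : ℝ → M} (hγ : IsMIntegralCurve γ X) (s t : ℝ) :
    g.val (γ s) (X (γ s)) (X (γ s)) = g.val (γ t) (X (γ t)) (X (γ t)) := by
  have hd : ∀ t, HasDerivAt (fun t' ↦ g.val (γ t') (X (γ t')) (X (γ t'))) 0 t := by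
    intro t
    have hf : MDiffAt (fun y ↦ g.val y (X y) (X y)) (γ t) :=
      g.mdifferentiableAt_val_apply (hX.mdifferentiableAt _) (hX.mdifferentiableAt _)
    have h1 := hasDerivAt_comp_curve hf (hγ t).mdifferentiableAt
    rw [velocity_eq_of_isMIntegralCurve hγ t] at h1
    have h0 : mfderiv I 𝓘(ℝ, ℝ) (fun y ↦ g.val y (X y) (X y)) (γ t) (X (γ t)) = 0 :=
      hX.mvfderiv_val_self_apply_self (γ t)
    rwa [h0] at h1
  exact is_const_of_deriv_eq_zero (fun t ↦ (hd t).differentiableAt) (fun t ↦ (hd t).deriv) s t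

end PseudoRiemannianMetric

/-! ### Stationary Killing fields timelike everywhere: lapse, timelike orbits, free action -/

namespace LorentzianMetric

variable [FiniteDimensional ℝ E] [CompleteSpace E] [Fact (1 ≤ n)]
  {g : LorentzianMetric I n M} {τ : TimeOrientation g} [g.HasLeviCivita]
  {X : Π x : M, TangentSpace I x}

omit [FiniteDimensional ℝ E] [CompleteSpace E] [Fact (1 ≤ n)] in
/-- **The lapse is positive.** For a stationary Killing field `X` timelike at every point,
`u² := -⟨X, X⟩ > 0` everywhere (Anderson 2000, §0, (0.2): "`u² = -⟨X, X⟩ > 0`").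
[cite: Anderson2000, §0, (0.2)] -/
theorem IsStationaryKilling.neg_val_self_pos (h : g.IsStationaryKilling τ X univ) (x : M) :
    0 < -g.val x (X x) (X x) :=
  neg_pos.mpr (h.isTimelike (mem_univ x)).1

/-- **The lapse is `G`-invariant.** For a stationary Killing field `X` (timelike everywhere) and an
integral curve `γ` of `X` — an orbit of the isometry group `G` generated by `X` — the lapse
`u² = -⟨X, X⟩` takes the same value at all points of the orbit (Anderson 2000, §0: the data
`u` of (0.1)–(0.2) live on the orbit space `S`). [cite: Anderson2000, §0, (0.1)–(0.2)] -/
theorem IsStationaryKilling.neg_val_self_apply_eq (h : g.IsStationaryKilling τ X univ)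
    {γ : ℝ → M} (hγ : IsMIntegralCurve γ X) (s t : ℝ) :
    -g.val (γ s) (X (γ s)) (X (γ s)) = -g.val (γ t) (X (γ t)) (X (γ t)) := by
  rw [h.isKillingField.val_self_apply_eq_of_isMIntegralCurve hγ s t]

omit [FiniteDimensional ℝ E] [CompleteSpace E] [Fact (1 ≤ n)] in
/-- **The orbits of `G` are time-like curves.** Every integral curve `γ` of a stationary Killing
field `X` which is future-directed timelike at every point is a future-directed timelike curve
(on any parameter set): its velocity at `t` is `X (γ t)`. Anderson 2000, §0 ("a smooth
1-parameter group `G ≈ ℝ` of isometries whose orbits are time-like curves in `M`").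
[cite: Anderson2000, §0] -/
theorem IsStationaryKilling.isFutureTimelikeCurveOn_of_isMIntegralCurve
    (h : g.IsStationaryKilling τ X univ) {γ : ℝ → M} (hγ : IsMIntegralCurve γ X) (s : Set ℝ) :
    g.IsFutureTimelikeCurveOn τ γ s := by
  intro t _
  refine ⟨(hγ t).mdifferentiableAt, ?_, ?_⟩
  · rw [velocity_eq_of_isMIntegralCurve hγ t]
    exact (h.isTimelike (mem_univ _)).1
  · rw [velocity_eq_of_isMIntegralCurve hγ t]
    exact (h.isTimelike (mem_univ _)).2

omit [FiniteDimensional ℝ E] [CompleteSpace E] [Fact (1 ≤ n)] in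
/-- **Chronology makes the isometric `ℝ`-action free.** In a chronological time-oriented
Lorentzian manifold, every integral curve of a stationary Killing field timelike at every point
is injective: if `γ a = γ b` with `a < b`, then `γ|[a, b]` would be a closed future timelike
curve. Thus the group generated by `X` is `G ≈ ℝ` acting freely, as in Anderson's standing
assumptions (Anderson 2000, §0: "`G ≈ ℝ`", "we assume throughout the paper that `M` is a
chronological space-time"; §1.1: without chronology one may take a `ℤ`-quotient and the orbit
space need not be a manifold). [cite: Anderson2000, §0 and §1.1] -/
theorem IsStationaryKilling.injective_of_isChronological (h : g.IsStationaryKilling τ X univ)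
    (hchr : g.IsChronological τ) {γ : ℝ → M} (hγ : IsMIntegralCurve γ X) :
    Function.Injective γ := by
  intro a b hab
  by_contra hne
  rcases lt_or_gt_of_ne hne with hlt | hlt
  · exact hchr γ a b hlt (h.isFutureTimelikeCurveOn_of_isMIntegralCurve hγ _) hab
  · exact hchr γ b a hlt (h.isFutureTimelikeCurveOn_of_isMIntegralCurve hγ _) hab.symm

omit [FiniteDimensional ℝ E] [CompleteSpace E] [Fact (1 ≤ n)] in
/-- **No circle orbits.** In a chronological time-oriented Lorentzian manifold no integral curve
of a stationary Killing field timelike at every point is periodic with a non-zero period: the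
isometry group generated by `X` is `ℝ`, not `S¹` (Anderson 2000, §0 and §1.1; a periodic orbit
would be a closed timelike curve, O'Neill 1983, Ch. 14, p. 407). [cite: Anderson2000, §0 and §1.1] -/
theorem IsStationaryKilling.not_periodic_of_isChronological (h : g.IsStationaryKilling τ X univ)
    (hchr : g.IsChronological τ) {γ : ℝ → M} (hγ : IsMIntegralCurve γ X) {c : ℝ} (hc : c ≠ 0) :
    ¬ Function.Periodic γ c := by
  intro hp
  have h0 : (0 : ℝ) + c = 0 := h.injective_of_isChronological hchr hγ (hp 0)
  exact hc (by simpa using h0)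

omit [FiniteDimensional ℝ E] [CompleteSpace E] [Fact (1 ≤ n)] in
/-- **Distinct times give distinct points on an orbit.** For the orbit `γ` of `x = γ 0` under the
flow of a stationary Killing field in a chronological Lorentzian manifold, `γ t = x` only for
`t = 0` (freeness of the `ℝ`-action, Anderson 2000, §0–§1.1). [cite: Anderson2000, §0 and §1.1] -/
theorem IsStationaryKilling.eq_zero_of_apply_eq_apply_zero (h : g.IsStationaryKilling τ X univ)
    (hchr : g.IsChronological τ) {γ : ℝ → M} (hγ : IsMIntegralCurve γ X) {t : ℝ}
    (ht : γ t = γ 0) : t = 0 :=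
  h.injective_of_isChronological hchr hγ ht

omit [FiniteDimensional ℝ E] [CompleteSpace E] [Fact (1 ≤ n)] in
/-- **Every point lies on a whole-line time-like orbit.** Through every point of `M` passes an
injective future-directed timelike curve `γ : ℝ → M`, namely the orbit of the point under the
complete stationary Killing flow (completeness of `X`, `isFutureTimelikeCurveOn_of_isMIntegralCurve`,
`injective_of_isChronological`). Anderson 2000, §0 (the projection `π : M → S` is a principal
`ℝ`-bundle with fibre `G`). [cite: Anderson2000, §0] -/
theorem IsStationaryKilling.exists_orbit (h : g.IsStationaryKilling τ X univ)
    (hchr : g.IsChronological τ) (x : M) :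
    ∃ γ : ℝ → M, IsMIntegralCurve γ X ∧ γ 0 = x ∧ Function.Injective γ ∧
      g.IsFutureTimelikeCurveOn τ γ univ := by
  obtain ⟨γ, hγ, h0⟩ := h.isCompleteVectorField x
  exact ⟨γ, hγ, h0, h.injective_of_isChronological hchr hγ,
    h.isFutureTimelikeCurveOn_of_isMIntegralCurve hγ univ⟩

end LorentzianMetric

/-! ### The bundled form used by the named fact -/

namespace Spacetime

universe u

variable {𝓢 : Spacetime.{u} 4} [𝓢.metric.HasLeviCivita]
  {X : Π x : 𝓢.carrier, TangentSpace (𝓡 4) x}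

/-- Under the hypotheses of `Anderson2000_completeStationaryVacuumFlat` (a four-dimensional
chronological spacetime with a complete Killing field timelike at every point), through every
event passes an injective, whole-line, future-directed timelike orbit of the stationary isometry
group, along which the lapse `u² = -⟨X, X⟩ > 0` is constant: the setting `π : M → S`, `G ≈ ℝ`,
`u > 0` on `S` of Anderson 2000, §0, in the prelude's vocabulary. [cite: Anderson2000, §0] -/
theorem IsStationaryKilling.exists_orbit_of_isChronological (hX : 𝓢.IsStationaryKilling X univ)
    (hchr : 𝓢.metric.IsChronological 𝓢.timeOrientation) (x : 𝓢.carrier) :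
    ∃ γ : ℝ → 𝓢.carrier, IsMIntegralCurve γ X ∧ γ 0 = x ∧ Function.Injective γ ∧
      𝓢.metric.IsFutureTimelikeCurveOn 𝓢.timeOrientation γ univ ∧
      ∀ t, -𝓢.metric.val (γ t) (X (γ t)) (X (γ t)) = -𝓢.metric.val x (X x) (X x) ∧
        0 < -𝓢.metric.val (γ t) (X (γ t)) (X (γ t)) := by
  obtain ⟨γ, hγ, h0, hinj, htl⟩ :=
    LorentzianMetric.IsStationaryKilling.exists_orbit hX hchr x
  refine ⟨γ, hγ, h0, hinj, htl, fun t ↦ ⟨?_, ?_⟩⟩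
  · have := LorentzianMetric.IsStationaryKilling.neg_val_self_apply_eq hX hγ t 0
    rwa [h0] at this
  · exact LorentzianMetric.IsStationaryKilling.neg_val_self_pos hX (γ t)

end Spacetime

/-! ### The acceleration of the Killing observers (Anderson 2000, §1.1–§1.2) -/

namespace PseudoRiemannianMetric

variable [FiniteDimensional ℝ E] [CompleteSpace E] [Fact (1 ≤ n)]
  {g : PseudoRiemannianMetric I n E (TangentSpace I : M → Type _)} [g.HasLeviCivita]
  {X : Π x : M, TangentSpace I x}

/-- **`Y⟨X, X⟩ = 2 g(∇_Y X, X)` for a Killing field** (indeed for any differentiable field `X`):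
the derivative of `y ↦ g_y(X_y, X_y)` at `x` in the direction of a tangent vector `Y₀` is
`2 g_x(∇_{Y₀} X, X_x)` — metric compatibility of the Levi-Civita connection
(`isLeviCivita_leviCivita_holds`) applied to the canonical local extension of `Y₀`
(`FiberBundle.extend`) and symmetry of `g`. O'Neill 1983, Ch. 3, Thm. 3.11 (D5) and Prop. 3.18 (3).
[cite: ONeill1983, Ch. 3, Thm. 3.11] -/
theorem IsKillingField.mvfderiv_val_self_apply (hX : g.IsKillingField X) (x : M)
    (Y₀ : TangentSpace I x) :
    mvfderiv I (fun y ↦ g.val y (X y) (X y)) x Y₀ = 2 * g.val x (g.leviCivita X x Y₀) (X x) := by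
  have hLC : g.IsLeviCivita g.leviCivita := isLeviCivita_leviCivita_holds
  have hXd : MDiffAt (T% X) x := hX.mdifferentiableAt x
  have hY : MDiffAt (T% (FiberBundle.extend E Y₀)) x := FiberBundle.mdifferentiableAt_extend ..
  have hc := hLC.2 hY hXd hXd
  rw [FiberBundle.extend_apply_self] at hc
  rw [hc, g.symm x (X x) (g.leviCivita X x Y₀)]
  ring

/-- **The acceleration of the Killing flow is half the gradient of the lapse squared.** For a
Killing field `X` and every tangent vector `Y₀` at `x`,
`2 g_x(Y₀, ∇_X X) = -Y₀⟨X, X⟩ = Y₀(u²)`, `u² = -⟨X, X⟩`: the Killing equation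
`g(∇_{Y₀} X, X) + g(Y₀, ∇_X X) = 0` combined with `Y₀⟨X, X⟩ = 2 g(∇_{Y₀} X, X)`
(`mvfderiv_val_self_apply`). Equivalently `∇_X X = ½ grad(u²) = u grad u`, i.e. the orbits of the
stationary isometry group have acceleration `grad log u` orthogonal to the level sets of the
lapse — the identity behind the vertical part `r_M(X, X)` ↔ `Δu` of the reduction of the vacuum
equations to the orbit data (Anderson 2000, §1.2, (1.4): "the equation (1.4) from the vertical
part of `r_M`, i.e. `r_M(X,X)`"); Wald, *General Relativity*, (C.3.1) ff. [cite: Anderson2000, §1.2, (1.4)] -/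
theorem IsKillingField.two_mul_val_leviCivita_self_apply_self (hX : g.IsKillingField X) (x : M)
    (Y₀ : TangentSpace I x) :
    2 * g.val x Y₀ (g.leviCivita X x (X x)) = -mvfderiv I (fun y ↦ g.val y (X y) (X y)) x Y₀ := by
  have hk := hX.val_leviCivita_add x Y₀ (X x)
  rw [hX.mvfderiv_val_self_apply x Y₀]
  linarith

omit [FiniteDimensional ℝ E] [CompleteSpace E] [Fact (1 ≤ n)] in
/-- **The acceleration of the Killing flow is horizontal**: `g(∇_X X, X) = 0` for a Killing field
`X` (the Killing equation at `Y = Z = X x`, halved). In Anderson's setting: the acceleration of the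
`G`-orbits lies in the horizontal distribution `𝓗 = ⟨X⟩^⊥` (Anderson 2000, §1.1: "the horizontal
distribution `𝓗` is its orthogonal complement in `TM`"). [cite: Anderson2000, §1.1] -/
theorem IsKillingField.val_leviCivita_self_apply_self_self (hX : g.IsKillingField X) (x : M) :
    g.val x (g.leviCivita X x (X x)) (X x) = 0 := by
  have hk := hX.val_leviCivita_add x (X x) (X x)
  rw [g.symm x (X x) (g.leviCivita X x (X x))] at hk
  linarith

omit [FiniteDimensional ℝ E] [CompleteSpace E] [Fact (1 ≤ n)] in
/-- **The lapse squared is `C^n`.** For a Killing field `X` of a `C^n` metric, the function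
`y ↦ -g_y(X_y, X_y)` (Anderson's `u²`, (0.2)) is `C^n` on `M` (`contMDiffAt_val_apply`).
[cite: Anderson2000, §0, (0.2)] -/
theorem IsKillingField.contMDiff_neg_val_self (hX : g.IsKillingField X) :
    CMDiff n (fun y ↦ -g.val y (X y) (X y)) := fun x ↦
  (g.contMDiffAt_val_apply le_rfl (hX.contMDiff x) (hX.contMDiff x)).neg

end PseudoRiemannianMetric

/-! ### The orbit space `S = M/G` as a quotient set (Anderson 2000, §0)

The orbits of a complete `C¹` vector field partition the manifold: the relation "`y` lies on the
orbit of `x`" (`y ∈ stationaryOrbit X {x}`) is an equivalence relation, whose quotient set is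
Anderson's orbit space `S` with projection `π : M → S`; each fibre `π⁻¹([x])` is the range of the
integral curve through `x`, a copy of `ℝ` when the flow is free. Only uniqueness of integral
curves (Mathlib's `isMIntegralCurve_Ioo_eq_of_contMDiff_boundaryless`, Hausdorff manifolds
without boundary) and time translation of integral curves (`IsMIntegralCurve.comp_add`) are
used; the smooth structure of `S` (a `3`-manifold when `M` is chronological, Anderson 2000, §0
and [Ha]) is not constructed here. -/

section OrbitSpace

variable {X : Π x : M, TangentSpace I x}

omit [IsManifold I ∞ M] in
/-- Unfolding lemma: `y` lies on the orbit of `x` iff some whole-line integral curve of `X`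
starts at `x` and passes through `y`. Chruściel–Costa 2008, (2.1) with `A = {x}`; Anderson 2000,
§0 (the orbits of `G`). [folklore] -/
theorem mem_stationaryOrbit_singleton_iff {x y : M} :
    y ∈ stationaryOrbit X {x} ↔ ∃ γ : ℝ → M, IsMIntegralCurve γ X ∧ γ 0 = x ∧ ∃ t : ℝ, γ t = y := by
  simp only [stationaryOrbit, mem_singleton_iff, mem_setOf_eq]

omit [IsManifold I ∞ M] in
/-- **The orbit relation is symmetric** (no regularity needed): if `y` lies on the orbit of `x`,
witnessed by the integral curve `γ` with `γ 0 = x`, `γ t = y`, then the time-translate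
`s ↦ γ (s + t)` is an integral curve starting at `y` and passing through `x` at `s = -t`
(Mathlib's `IsMIntegralCurve.comp_add`). Anderson 2000, §0 (`G` is a group). [folklore] -/
theorem mem_stationaryOrbit_singleton_symm {x y : M} (h : y ∈ stationaryOrbit X {x}) :
    x ∈ stationaryOrbit X {y} := by
  obtain ⟨γ, hγ, h0, t, ht⟩ := mem_stationaryOrbit_singleton_iff.1 h
  refine mem_stationaryOrbit_singleton_iff.2 ⟨γ ∘ (· + t), hγ.comp_add t, ?_, -t, ?_⟩
  · simpa using ht
  · simpa using h0

variable [T2Space M] [BoundarylessManifold I M]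

/-- **Flow law.** For a `C¹` vector field on a Hausdorff manifold without boundary, an integral
curve `δ` starting at the point `γ s` of an integral curve `γ` is the time-translate of `γ`:
`δ t = γ (t + s)` for all `t` (uniqueness of integral curves, Mathlib's
`isMIntegralCurve_Ioo_eq_of_contMDiff_boundaryless`, applied to `δ` and `γ ∘ (· + s)`). This is
the group law `φ_t ∘ φ_s = φ_{t+s}` of the flow `G` (Anderson 2000, §0: "a smooth 1-parameter
group `G ≈ ℝ`"; O'Neill 1983, Ch. 1, Def. 1.52 ff.). [folklore] -/
theorem apply_eq_apply_add_of_isMIntegralCurve (hX : CMDiff 1 (T% X)) {γ δ : ℝ → M}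
    (hγ : IsMIntegralCurve γ X) (hδ : IsMIntegralCurve δ X) {s : ℝ} (h : δ 0 = γ s) (t : ℝ) :
    δ t = γ (t + s) := by
  have key : δ = γ ∘ (· + s) :=
    isMIntegralCurve_Ioo_eq_of_contMDiff_boundaryless (t₀ := 0) hX hδ (hγ.comp_add s)
      (by simpa using h)
  exact congrFun key t

/-- **The orbit relation is transitive** for a `C¹` vector field on a Hausdorff manifold without
boundary (flow law `apply_eq_apply_add_of_isMIntegralCurve`). Anderson 2000, §0 (`G` is a group acting on
`M`; `S` is its orbit space). [folklore] -/
theorem mem_stationaryOrbit_singleton_trans (hX : CMDiff 1 (T% X)) {x y z : M}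
    (hxy : y ∈ stationaryOrbit X {x}) (hyz : z ∈ stationaryOrbit X {y}) :
    z ∈ stationaryOrbit X {x} := by
  obtain ⟨γ, hγ, hγ0, s, hs⟩ := mem_stationaryOrbit_singleton_iff.1 hxy
  obtain ⟨δ, hδ, hδ0, t, ht⟩ := mem_stationaryOrbit_singleton_iff.1 hyz
  refine mem_stationaryOrbit_singleton_iff.2 ⟨γ, hγ, hγ0, t + s, ?_⟩
  rw [← ht, apply_eq_apply_add_of_isMIntegralCurve hX hγ hδ (hδ0.trans hs.symm) t]

/-- **The orbits of a complete `C¹` vector field partition the manifold**: "lies on the orbit of"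
is an equivalence relation on `M` (reflexive by completeness, `subset_stationaryOrbit`; symmetric
by time reversal of the parameter; transitive by uniqueness of integral curves). Its quotient set
is the orbit space `S = M/G` of Anderson 2000, §0 ("Let `S` be the orbit space of the action `G`
… the projection `π : M → S`"), here for any complete `C¹` field on a Hausdorff manifold without
boundary. [cite: Anderson2000, §0] -/
theorem IsCompleteVectorField.equivalence_mem_stationaryOrbit (hX : CMDiff 1 (T% X))
    (hc : IsCompleteVectorField X) :
    Equivalence fun x y : M ↦ y ∈ stationaryOrbit X {x} where
  refl x := subset_stationaryOrbit hc {x} (mem_singleton x)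
  symm h := mem_stationaryOrbit_singleton_symm h
  trans h h' := mem_stationaryOrbit_singleton_trans hX h h'

/-- **Each orbit is the range of the integral curve through its base point** (the fibre
`π⁻¹([x]) = G · x` of Anderson's projection `π : M → S`, §0): for a `C¹` field on a Hausdorff
manifold without boundary and an integral curve `γ` with `γ 0 = x`, `stationaryOrbit X {x}` is
exactly `range γ` (any other integral curve through `x` coincides with `γ`). [cite: Anderson2000, §0] -/
theorem stationaryOrbit_singleton_eq_range_of_isMIntegralCurve (hX : CMDiff 1 (T% X)) {γ : ℝ → M}
    (hγ : IsMIntegralCurve γ X) {x : M} (h0 : γ 0 = x) : stationaryOrbit X {x} = range γ := by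
  ext y
  rw [mem_stationaryOrbit_singleton_iff, mem_range]
  constructor
  · rintro ⟨δ, hδ, hδ0, t, rfl⟩
    refine ⟨t + 0, ?_⟩
    rw [← apply_eq_apply_add_of_isMIntegralCurve hX hγ hδ (hδ0.trans h0.symm) t]
  · rintro ⟨t, rfl⟩
    exact ⟨γ, hγ, h0, t, rfl⟩

end OrbitSpace

namespace LorentzianMetric

variable [FiniteDimensional ℝ E] [CompleteSpace E] [Fact (1 ≤ n)] [T2Space M]
  [BoundarylessManifold I M] {g : LorentzianMetric I n M} {τ : TimeOrientation g}
  [g.HasLeviCivita] {X : Π x : M, TangentSpace I x}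

omit [FiniteDimensional ℝ E] [CompleteSpace E] [T2Space M] [BoundarylessManifold I M] in
/-- A stationary Killing field is `C¹` as a section of `TM` (it is `C^n`, `n ≥ 1`), the
regularity under which its integral curves are unique. O'Neill 1983, Ch. 9, Def. 9.22. [folklore] -/
theorem IsStationaryKilling.contMDiff_one {Mext : Set M} (h : g.IsStationaryKilling τ X Mext) :
    CMDiff 1 (T% X) :=
  h.isKillingField.contMDiff.of_le Fact.out

omit [FiniteDimensional ℝ E] [CompleteSpace E] in
/-- **The orbit space of a stationary space-time as a quotient set.** For a stationary Killing
field `X` (complete, `C^n`) of a time-oriented Lorentzian manifold that is Hausdorff and without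
boundary, "lies on the same `G`-orbit" is an equivalence relation on `M`; its quotient is
Anderson's orbit space `S`, with `π : M → S` the quotient map (Anderson 2000, §0). Timelikeness on
`Mext` is not used. [cite: Anderson2000, §0] -/
theorem IsStationaryKilling.equivalence_mem_stationaryOrbit {Mext : Set M}
    (h : g.IsStationaryKilling τ X Mext) :
    Equivalence fun x y : M ↦ y ∈ stationaryOrbit X {x} :=
  h.isCompleteVectorField.equivalence_mem_stationaryOrbit h.contMDiff_one

omit [FiniteDimensional ℝ E] [CompleteSpace E] in
/-- **The fibres of `π : M → S` are lines.** Under the chronology condition, the `G`-orbit of every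
point `x` of a Lorentzian manifold (Hausdorff, without boundary) carrying a stationary Killing
field timelike at every point is the range of an *injective* whole-line integral curve through
`x`: set-theoretically `π : M → S` is a bundle of real lines, "a principal `ℝ`-bundle, with fibre
`G`" (Anderson 2000, §0). [cite: Anderson2000, §0] -/
theorem IsStationaryKilling.exists_stationaryOrbit_eq_range (h : g.IsStationaryKilling τ X univ)
    (hchr : g.IsChronological τ) (x : M) :
    ∃ γ : ℝ → M, IsMIntegralCurve γ X ∧ γ 0 = x ∧ Function.Injective γ ∧
      stationaryOrbit X {x} = range γ := by
  obtain ⟨γ, hγ, h0⟩ := h.isCompleteVectorField x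
  exact ⟨γ, hγ, h0, h.injective_of_isChronological hchr hγ,
    stationaryOrbit_singleton_eq_range_of_isMIntegralCurve h.contMDiff_one hγ h0⟩

end LorentzianMetric

end Literature.Geometry.Lorentzian

end
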